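import Literature.MathematicalPhysics.QuantumManyBody.PeriodicFeynmanKacCell
import Literature.MathematicalPhysics.QuantumManyBody.GroundStateFeynmanKacFreeForm
import HarnessLib

/-!
# Periodic Feynman–Kac: the free small-time form on the fundamental cell

Topic `Literature/MathematicalPhysics/QuantumManyBody`; support file for the proof of the named
fact `Literature.MathematicalPhysics.QuantumManyBody.BoseGas.PeriodicGroundStateFeynmanKac`
(`PeriodicHeatFlowSpectral.lean`), torus twin of `GroundStateFeynmanKacFreeForm.lean`: part of
the variational identification of the top of the spectrum of the torus Feynman–Kac semigroup
with the periodic form (Chung–Zhao (1995) Thm 3.27 / Prop 3.29 (81), here on the torus) by direct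
small-time analysis. The FREE part of that analysis for PERIODIC `f : (ℝ³)^N → ℝ` and `t ≥ 0` is

  `sqIncrCell L t f = E ∫_{[0,L)^{3N}} (f(X + √2 b_t) - f(X))² dX ∈ [0, ∞]`,

the Gaussian-averaged squared increment on the cell, i.e. `2 (‖f‖²_cell - ⟨f, e^{tΔ} f⟩_cell)`.
Proved here:

* `measurePreserving_cellShift`, `setIntegral_cellN_comp_add_of_periodic` — **the shift of the
  torus is measure preserving**: `X ↦ (X + C) mod (Lℤ³)^N` preserves `dX|_cell`, so cell integrals
  (lower and Bochner) of periodic functions are shift invariant;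
* `integral_cellN_mul_integral_shift_eq` — **the square identity**
  `∫_cell f(X) E[f(X + √2 b_t)] dX = ‖f‖²_cell - sqIncrCell t f / 2` for periodic `f ∈ L²(cell)`;
* `sqIncrCell_le_kinetic` — **the `C¹` upper bound** `sqIncrCell t φ ≤ 2t ∫_cell |∇φ|²` for every
  periodic `C¹` function `φ` (fundamental theorem of calculus along the segment, Jensen, shift
  invariance of cell integrals, and the covariance `E[ℓ(√2 b_t)²] = 2t ∑ ℓ(e_{ik})²`);
* `kinetic_le_liminf_sqIncrCell` — **the Fatou lower bound**
  `∫_cell |∇φ|² ≤ liminf_{t → 0⁺} sqIncrCell t φ / (2t)` for periodic `C¹` `φ`;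
* `sqIncrCell_conv_le` — **mollification does not increase it**: for a probability measure `ν`
  and bounded measurable periodic `g`, `sqIncrCell t (x ↦ ∫ g(x - y) dν(y)) ≤ sqIncrCell t g`.

All one-variable / Gaussian ingredients (`realKinetic`, `sq_sub_le_integral_sq_fderiv`,
`lintegral_clm_displacement_sq`, `tendsto_sqIncr_integrand`, `lintegral_stdGaussian_smul`,
`sq_sub_conv_le`, …) are those of the Dirichlet file.

## References

* K. L. Chung, Z. Zhao, *From Brownian Motion to Schrödinger's Equation* (1995), Thm 3.27,
  Prop 3.29 (81). [ChungZhao1995]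
* M. Fukushima, Y. Oshima, M. Takeda, *Dirichlet Forms and Symmetric Markov Processes* (2011),
  §1.3–1.4. [folklore]
-/

noncomputable section

namespace Literature.MathematicalPhysics.QuantumManyBody.BoseGas

open MeasureTheory ProbabilityTheory Filter Set intervalIntegral
open scoped ENNReal NNReal Topology
open Literature.Probability.Process

variable {N : ℕ}

/-! ### The shift of the torus is measure preserving -/

/-- **The torus shift `X ↦ (X + C) mod (Lℤ³)^N` preserves the Haar measure `dX|_{[0,L)^{3N}}`.**
[folklore] -/
theorem measurePreserving_cellShift {L : ℝ} (hL : 0 < L) (C : Config N) :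
    MeasurePreserving (fun X : Config N => cellProj L (X + C)) (volume.restrict (cellN N L))
      (volume.restrict (cellN N L)) := by
  have hTm : Measurable fun X : Config N => cellProj L (X + C) :=
    (measurable_cellProj L).comp (measurable_id.add_const C)
  refine ⟨hTm, Measure.ext fun A hA => ?_⟩
  rw [Measure.map_apply hTm hA, ← lintegral_indicator_one (hTm hA),
    ← lintegral_indicator_one hA]
  -- `𝟙_A ∘ cellProj` is periodic; shift invariance of its cell integral
  have hper : ∀ (X : Config N) (i : Fin N) (k : Fin 3),
      (A.indicator (1 : Config N → ℝ≥0∞) ∘ cellProj L) (X + Pi.single i (EuclideanSpace.single k L)) =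
        (A.indicator (1 : Config N → ℝ≥0∞) ∘ cellProj L) X :=
    comp_cellProj_periodic hL.ne' _
  have h1 := lintegral_cellN_comp_add hL hper C
  have h2 := setLIntegral_cellN_comp_cellProj hL (A.indicator (1 : Config N → ℝ≥0∞))
  have h3 : ((fun X : Config N => cellProj L (X + C)) ⁻¹' A).indicator (1 : Config N → ℝ≥0∞) =
      fun X => (A.indicator (1 : Config N → ℝ≥0∞) ∘ cellProj L) (X + C) := by
    funext X
    by_cases hX : cellProj L (X + C) ∈ A
    · simp [hX]
    · simp [hX]
  rw [h3, h1, h2]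
  where
  /-- The periodic extension agrees with the function on the cell (local copy of
  `setLIntegral_cellN_comp_cellProj` of `PeriodicFeynmanKacOperator.lean`, outside this import
  cone). [folklore] -/
  setLIntegral_cellN_comp_cellProj {L : ℝ} (hL : 0 < L) (F : Config N → ℝ≥0∞) :
      ∫⁻ Y in cellN N L, (F ∘ cellProj L) Y = ∫⁻ Y in cellN N L, F Y :=
    setLIntegral_congr_fun (measurableSet_cellN N L) fun _ hY => comp_cellProj_apply_of_mem hL F hY

/-- **Shift invariance of cell Bochner integrals of periodic functions**: for `F` periodic in
every particle (any Banach codomain), `∫_{[0,L)^{3N}} F(X + C) dX = ∫_{[0,L)^{3N}} F(X) dX`.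
[folklore] -/
theorem setIntegral_cellN_comp_add_of_periodic {E : Type*} [NormedAddCommGroup E] [NormedSpace ℝ E]
    {L : ℝ} (hL : 0 < L) {F : Config N → E} (hF : AEStronglyMeasurable F (volume.restrict (cellN N L)))
    (hper : ∀ (X : Config N) (i : Fin N) (k : Fin 3),
      F (X + Pi.single i (EuclideanSpace.single k L)) = F X)
    (C : Config N) : ∫ X in cellN N L, F (X + C) = ∫ X in cellN N L, F X := by
  have hT := measurePreserving_cellShift (N := N) hL C
  have h1 : (fun X : Config N => F (X + C)) = fun X : Config N => F (cellProj L (X + C)) := by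
    funext X
    rw [apply_cellProj_of_periodic hper]
  rw [h1, ← integral_map hT.measurable.aemeasurable (by rw [hT.map_eq]; exact hF), hT.map_eq]

/-- **Integrability is shift invariant on the torus**: for periodic `F`, `F(· + C)` is integrable
on the cell iff `F` is. [folklore] -/
theorem integrableOn_cellN_comp_add_of_periodic {E : Type*} [NormedAddCommGroup E]
    {L : ℝ} (hL : 0 < L) {F : Config N → E} (hF : AEStronglyMeasurable F (volume.restrict (cellN N L)))
    (hper : ∀ (X : Config N) (i : Fin N) (k : Fin 3),
      F (X + Pi.single i (EuclideanSpace.single k L)) = F X)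
    (C : Config N) (hint : Integrable F (volume.restrict (cellN N L))) :
    Integrable (fun X => F (X + C)) (volume.restrict (cellN N L)) := by
  have hT := measurePreserving_cellShift (N := N) hL C
  have h1 : (fun X : Config N => F (X + C)) = F ∘ fun X : Config N => cellProj L (X + C) := by
    funext X
    simp only [Function.comp_apply, apply_cellProj_of_periodic hper]
  rw [h1]
  exact (hT.integrable_comp hF).2 hint

/-- **`MemLp` is shift invariant on the torus**: for periodic `F ∈ L^p(cell)`, so is `F(· + C)`.
[folklore] -/
theorem memLp_cellN_comp_add_of_periodic {E : Type*} [NormedAddCommGroup E] {p : ℝ≥0∞}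
    {L : ℝ} (hL : 0 < L) {F : Config N → E} (hF : MemLp F p (volume.restrict (cellN N L)))
    (hper : ∀ (X : Config N) (i : Fin N) (k : Fin 3),
      F (X + Pi.single i (EuclideanSpace.single k L)) = F X)
    (C : Config N) : MemLp (fun X => F (X + C)) p (volume.restrict (cellN N L)) := by
  have hT := measurePreserving_cellShift (N := N) hL C
  have h1 : (fun X : Config N => F (X + C)) = F ∘ fun X : Config N => cellProj L (X + C) := by
    funext X
    simp only [Function.comp_apply, apply_cellProj_of_periodic hper]
  rw [h1]
  exact hF.comp_measurePreserving hT

/-! ### Periodicity of derivatives -/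

/-- **The derivative of a periodic function is periodic.** [folklore] -/
theorem fderiv_periodic {L : ℝ} {φ : Config N → ℝ}
    (hper : ∀ (X : Config N) (i : Fin N) (k : Fin 3),
      φ (X + Pi.single i (EuclideanSpace.single k L)) = φ X)
    (X : Config N) (i : Fin N) (k : Fin 3) :
    fderiv ℝ φ (X + Pi.single i (EuclideanSpace.single k L)) = fderiv ℝ φ X := by
  have h : (fun Y => φ (Y + Pi.single i (EuclideanSpace.single k L))) = φ := funext fun Y => hper Y i k
  rw [← fderiv_comp_add_right, h]

/-- The real kinetic density of a periodic function is periodic. [folklore] -/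
theorem realKinetic_periodic {L : ℝ} {φ : Config N → ℝ}
    (hper : ∀ (X : Config N) (i : Fin N) (k : Fin 3),
      φ (X + Pi.single i (EuclideanSpace.single k L)) = φ X)
    (X : Config N) (i : Fin N) (k : Fin 3) :
    realKinetic φ (X + Pi.single i (EuclideanSpace.single k L)) = realKinetic φ X := by
  simp only [realKinetic, fderiv_periodic hper]

/-! ### The Gaussian-averaged squared increment on the cell -/

/-- The **Gaussian-averaged squared increment on the cell**
`E ∫_{[0,L)^{3N}} (f(X + √2 b_t) - f(X))² dX ∈ [0, ∞]` of `f : (ℝ³)^N → ℝ` at time `t` (for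
periodic `f`: twice `‖f‖²_cell - ⟨f, e^{tΔ}f⟩_cell`). [folklore] -/
def sqIncrCell (L : ℝ) (t : ℝ≥0) (f : Config N → ℝ) : ℝ≥0∞ :=
  ∫⁻ ω, ∫⁻ X in cellN N L, ENNReal.ofReal ((f (X + displacement t ω) - f X) ^ 2) ∂volume
    ∂wienerPaths N

/-- The cell shift functional `h ↦ ∫_cell (f(X + h) - f X)² dX` is measurable in the shift.
[folklore] -/
theorem measurable_setLIntegral_cellN_shift_sq (L : ℝ) {f : Config N → ℝ} (hf : Measurable f) :
    Measurable fun h : Config N => ∫⁻ X in cellN N L, ENNReal.ofReal ((f (X + h) - f X) ^ 2) := by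
  have hm : Measurable fun p : Config N × Config N => ENNReal.ofReal ((f (p.2 + p.1) - f p.2) ^ 2) :=
    ENNReal.measurable_ofReal.comp
      (((hf.comp (measurable_snd.add measurable_fst)).sub (hf.comp measurable_snd)).pow_const 2)
  exact hm.lintegral_prod_right'

/-- `sqIncrCell` through the cell shift functional: `sqIncrCell t f = E[S_f(√2 b_t)]`. [folklore] -/
theorem sqIncrCell_eq_lintegral_shift (L : ℝ) (t : ℝ≥0) (f : Config N → ℝ) :
    sqIncrCell L t f = ∫⁻ ω, (fun h : Config N => ∫⁻ X in cellN N L,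
      ENNReal.ofReal ((f (X + h) - f X) ^ 2)) (displacement t ω) ∂wienerPaths N := rfl

/-- At `t = 0` there is no increment. [folklore] -/
@[simp] theorem sqIncrCell_zero (L : ℝ) (f : Config N → ℝ) : sqIncrCell (N := N) L 0 f = 0 := by
  simp [sqIncrCell]

/-- The squared cell mass of a periodic function is shift invariant. [folklore] -/
theorem setLIntegral_cellN_sq_comp_add {L : ℝ} (hL : 0 < L) {f : Config N → ℝ}
    (hper : ∀ (X : Config N) (i : Fin N) (k : Fin 3),
      f (X + Pi.single i (EuclideanSpace.single k L)) = f X) (h : Config N) :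
    ∫⁻ X in cellN N L, ENNReal.ofReal (f (X + h) ^ 2) = ∫⁻ X in cellN N L, ENNReal.ofReal (f X ^ 2) :=
  lintegral_cellN_comp_add hL (G := fun X => ENNReal.ofReal (f X ^ 2))
    (fun X i k => by simp only [hper]) h

/-- The cell shift functional of a periodic function is bounded by `4 ‖f‖²_cell`. [folklore] -/
theorem setLIntegral_cellN_shift_sq_le {L : ℝ} (hL : 0 < L) {f : Config N → ℝ} (hf : Measurable f)
    (hper : ∀ (X : Config N) (i : Fin N) (k : Fin 3),
      f (X + Pi.single i (EuclideanSpace.single k L)) = f X) (h : Config N) :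
    ∫⁻ X in cellN N L, ENNReal.ofReal ((f (X + h) - f X) ^ 2) ≤
      4 * ∫⁻ X in cellN N L, ENNReal.ofReal (f X ^ 2) := by
  have hm0 : Measurable fun X : Config N => ENNReal.ofReal (f X ^ 2) :=
    ENNReal.measurable_ofReal.comp (hf.pow_const 2)
  have hm1 : Measurable fun X : Config N => ENNReal.ofReal (f (X + h) ^ 2) :=
    ENNReal.measurable_ofReal.comp ((hf.comp (measurable_add_const h)).pow_const 2)
  have hpt : ∀ X : Config N, ENNReal.ofReal ((f (X + h) - f X) ^ 2) ≤
      2 * ENNReal.ofReal (f (X + h) ^ 2) + 2 * ENNReal.ofReal (f X ^ 2) := fun X => by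
    calc ENNReal.ofReal ((f (X + h) - f X) ^ 2)
        ≤ ENNReal.ofReal (2 * f (X + h) ^ 2 + 2 * f X ^ 2) :=
          ENNReal.ofReal_le_ofReal (sub_sq_le_two_mul _ _)
      _ = 2 * ENNReal.ofReal (f (X + h) ^ 2) + 2 * ENNReal.ofReal (f X ^ 2) := by
          rw [ENNReal.ofReal_add (by positivity) (by positivity), ENNReal.ofReal_mul zero_le_two,
            ENNReal.ofReal_mul zero_le_two, ENNReal.ofReal_ofNat]
  calc ∫⁻ X in cellN N L, ENNReal.ofReal ((f (X + h) - f X) ^ 2)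
      ≤ ∫⁻ X in cellN N L, (2 * ENNReal.ofReal (f (X + h) ^ 2) + 2 * ENNReal.ofReal (f X ^ 2)) :=
        lintegral_mono hpt
    _ = (2 * ∫⁻ X in cellN N L, ENNReal.ofReal (f (X + h) ^ 2)) +
          2 * ∫⁻ X in cellN N L, ENNReal.ofReal (f X ^ 2) := by
        rw [lintegral_add_left (hm1.const_mul 2), lintegral_const_mul 2 hm1,
          lintegral_const_mul 2 hm0]
    _ = 4 * ∫⁻ X in cellN N L, ENNReal.ofReal (f X ^ 2) := by
        rw [setLIntegral_cellN_sq_comp_add hL hper, ← add_mul]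
        norm_num

/-- `sqIncrCell t f ≤ 4 ‖f‖²_cell` for periodic `f`. [folklore] -/
theorem sqIncrCell_le {L : ℝ} (hL : 0 < L) {f : Config N → ℝ} (hf : Measurable f)
    (hper : ∀ (X : Config N) (i : Fin N) (k : Fin 3),
      f (X + Pi.single i (EuclideanSpace.single k L)) = f X) (t : ℝ≥0) :
    sqIncrCell L t f ≤ 4 * ∫⁻ X in cellN N L, ENNReal.ofReal (f X ^ 2) := by
  calc sqIncrCell L t f ≤ ∫⁻ _ω, (4 * ∫⁻ X in cellN N L, ENNReal.ofReal (f X ^ 2)) ∂wienerPaths N :=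
        lintegral_mono fun ω => setLIntegral_cellN_shift_sq_le hL hf hper _
    _ = 4 * ∫⁻ X in cellN N L, ENNReal.ofReal (f X ^ 2) := by
        rw [lintegral_const, measure_univ, mul_one]

/-- `sqIncrCell t f < ∞` for periodic `f ∈ L²(cell)`. [folklore] -/
theorem sqIncrCell_lt_top {L : ℝ} (hL : 0 < L) {f : Config N → ℝ} (hf : Measurable f)
    (hper : ∀ (X : Config N) (i : Fin N) (k : Fin 3),
      f (X + Pi.single i (EuclideanSpace.single k L)) = f X)
    (hf2 : ∫⁻ X in cellN N L, ENNReal.ofReal (f X ^ 2) ≠ ⊤) (t : ℝ≥0) : sqIncrCell L t f < ⊤ :=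
  (sqIncrCell_le hL hf hper t).trans_lt (ENNReal.mul_lt_top (by norm_num) hf2.lt_top)

/-! ### The square identity on the cell -/

/-- **The square identity for a fixed shift, on the cell**:
`∫_cell f(X) f(X + h) dX = ∫_cell f² - ½ ∫_cell (f(X + h) - f X)² dX` for periodic `f ∈ L²(cell)`.
[folklore] -/
theorem integral_cellN_mul_shift_eq {L : ℝ} (hL : 0 < L) {f : Config N → ℝ}
    (hf2 : MemLp f 2 (volume.restrict (cellN N L)))
    (hper : ∀ (X : Config N) (i : Fin N) (k : Fin 3),
      f (X + Pi.single i (EuclideanSpace.single k L)) = f X) (h : Config N) :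
    ∫ X in cellN N L, f X * f (X + h) =
      (∫ X in cellN N L, f X ^ 2) - (1 / 2) * ∫ X in cellN N L, (f (X + h) - f X) ^ 2 := by
  have hf2h : MemLp (fun X => f (X + h)) 2 (volume.restrict (cellN N L)) :=
    memLp_cellN_comp_add_of_periodic hL hf2 hper h
  have hsq : Integrable (fun X => f X ^ 2) (volume.restrict (cellN N L)) := hf2.integrable_sq
  have hsqh : Integrable (fun X => f (X + h) ^ 2) (volume.restrict (cellN N L)) := hf2h.integrable_sq
  have hprod : Integrable (fun X => f X * f (X + h)) (volume.restrict (cellN N L)) :=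
    hf2.integrable_mul hf2h
  have hexp : ∀ X, (f (X + h) - f X) ^ 2 = f (X + h) ^ 2 - 2 * (f X * f (X + h)) + f X ^ 2 := by
    intro X; ring
  simp_rw [hexp]
  have h1 : Integrable (fun X => f (X + h) ^ 2 - 2 * (f X * f (X + h))) (volume.restrict (cellN N L)) :=
    hsqh.sub (hprod.const_mul 2)
  have htrans : ∫ X in cellN N L, f (X + h) ^ 2 = ∫ X in cellN N L, f X ^ 2 :=
    setIntegral_cellN_comp_add_of_periodic hL (F := fun X => f X ^ 2) hsq.aestronglyMeasurable
      (fun X i k => by simp only [hper]) h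
  rw [integral_add h1 hsq, integral_sub hsqh (hprod.const_mul 2), MeasureTheory.integral_const_mul,
    htrans]
  ring

/-- Joint finiteness: `∫∫_cell f(X + √2 b_t)² dX dW = ‖f‖²_cell` for periodic `f`. [folklore] -/
theorem lintegral_prod_cellN_sq_comp_add_displacement {L : ℝ} (hL : 0 < L) {f : Config N → ℝ}
    (hf : Measurable f)
    (hper : ∀ (X : Config N) (i : Fin N) (k : Fin 3),
      f (X + Pi.single i (EuclideanSpace.single k L)) = f X) (t : ℝ≥0) :
    ∫⁻ p : Config N × PathSpace N, ENNReal.ofReal (f (p.1 + displacement t p.2) ^ 2)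
      ∂((volume.restrict (cellN N L)).prod (wienerPaths N)) =
        ∫⁻ X in cellN N L, ENNReal.ofReal (f X ^ 2) := by
  have hm : Measurable fun p : Config N × PathSpace N =>
      ENNReal.ofReal (f (p.1 + displacement t p.2) ^ 2) :=
    ENNReal.measurable_ofReal.comp
      ((hf.comp (measurable_fst.add ((measurable_displacement t).comp measurable_snd))).pow_const 2)
  rw [lintegral_prod_symm _ hm.aemeasurable]
  simp only
  have : ∀ ω : PathSpace N, ∫⁻ X in cellN N L, ENNReal.ofReal (f (X + displacement t ω) ^ 2) =
      ∫⁻ X in cellN N L, ENNReal.ofReal (f X ^ 2) := fun ω => setLIntegral_cellN_sq_comp_add hL hper _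
  simp_rw [this]
  rw [lintegral_const, measure_univ, mul_one]

/-- The pairing integrand `(X, ω) ↦ f(X) f(X + √2 b_t(ω))` is integrable on `cell × paths` for
periodic `f ∈ L²(cell)` (`|ab| ≤ (a² + b²)/2`, Tonelli, shift invariance). [folklore] -/
theorem integrable_mul_comp_add_displacement_cellN {L : ℝ} (hL : 0 < L) {f : Config N → ℝ}
    (hf : Measurable f) (hf2 : MemLp f 2 (volume.restrict (cellN N L)))
    (hper : ∀ (X : Config N) (i : Fin N) (k : Fin 3),
      f (X + Pi.single i (EuclideanSpace.single k L)) = f X) (t : ℝ≥0) :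
    Integrable (fun p : Config N × PathSpace N => f p.1 * f (p.1 + displacement t p.2))
      ((volume.restrict (cellN N L)).prod (wienerPaths N)) := by
  have hmeas : Measurable fun p : Config N × PathSpace N => f p.1 * f (p.1 + displacement t p.2) :=
    (hf.comp measurable_fst).mul
      (hf.comp (measurable_fst.add ((measurable_displacement t).comp measurable_snd)))
  refine ⟨hmeas.aestronglyMeasurable, ?_⟩
  have hsq : ∫⁻ X in cellN N L, ENNReal.ofReal (f X ^ 2) < ⊤ := by
    have := hf2.integrable_sq
    exact (hasFiniteIntegral_iff_ofReal (Eventually.of_forall fun X => sq_nonneg _)).1 this.2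
  refine lt_of_le_of_lt (lintegral_mono fun p => ?_ : ∫⁻ p, ‖f p.1 * f (p.1 + displacement t p.2)‖ₑ
      ∂((volume.restrict (cellN N L)).prod (wienerPaths N)) ≤
      ∫⁻ p, (ENNReal.ofReal (f p.1 ^ 2) + ENNReal.ofReal (f (p.1 + displacement t p.2) ^ 2))
        ∂((volume.restrict (cellN N L)).prod (wienerPaths N))) ?_
  · rw [Real.enorm_eq_ofReal_abs, ← ENNReal.ofReal_add (sq_nonneg _) (sq_nonneg _)]
    refine ENNReal.ofReal_le_ofReal ?_
    rw [abs_mul]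
    nlinarith [sq_nonneg (|f p.1| - |f (p.1 + displacement t p.2)|), sq_abs (f p.1),
      sq_abs (f (p.1 + displacement t p.2))]
  · have hmA : Measurable fun p : Config N × PathSpace N => ENNReal.ofReal (f p.1 ^ 2) :=
      ENNReal.measurable_ofReal.comp ((hf.comp measurable_fst).pow_const 2)
    rw [lintegral_add_left hmA, lintegral_prod_cellN_sq_comp_add_displacement hL hf hper t]
    have h1 : ∫⁻ p : Config N × PathSpace N, ENNReal.ofReal (f p.1 ^ 2)
        ∂((volume.restrict (cellN N L)).prod (wienerPaths N)) = ∫⁻ X in cellN N L, ENNReal.ofReal (f X ^ 2) := by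
      rw [lintegral_prod _ hmA.aemeasurable]
      simp only [lintegral_const, measure_univ, mul_one]
    rw [h1]
    exact ENNReal.add_lt_top.2 ⟨hsq, hsq⟩

/-- The cell shift functional along the displacement is integrable in the sample and its
expectation is `sqIncrCell` (read in `ℝ`). [folklore] -/
theorem integral_shift_sq_displacement_cellN {L : ℝ} (hL : 0 < L) {f : Config N → ℝ}
    (hf : Measurable f) (hf2 : MemLp f 2 (volume.restrict (cellN N L)))
    (hper : ∀ (X : Config N) (i : Fin N) (k : Fin 3),
      f (X + Pi.single i (EuclideanSpace.single k L)) = f X) (t : ℝ≥0) :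
    Integrable (fun ω : PathSpace N => ∫ X in cellN N L, (f (X + displacement t ω) - f X) ^ 2)
        (wienerPaths N) ∧
      ∫ ω, (∫ X in cellN N L, (f (X + displacement t ω) - f X) ^ 2) ∂wienerPaths N =
        (sqIncrCell L t f).toReal := by
  have hsq : ∫⁻ X in cellN N L, ENNReal.ofReal (f X ^ 2) ≠ ⊤ := by
    have := hf2.integrable_sq
    exact ((hasFiniteIntegral_iff_ofReal (Eventually.of_forall fun X => sq_nonneg _)).1 this.2).ne
  -- the inner integral as `toReal` of the inner lower integral
  have hinner : ∀ ω : PathSpace N, ∫ X in cellN N L, (f (X + displacement t ω) - f X) ^ 2 =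
      (∫⁻ X in cellN N L, ENNReal.ofReal ((f (X + displacement t ω) - f X) ^ 2)).toReal := by
    intro ω
    have hint : Integrable (fun X => (f (X + displacement t ω) - f X) ^ 2) (volume.restrict (cellN N L)) := by
      have := ((memLp_cellN_comp_add_of_periodic hL hf2 hper (displacement t ω)).sub hf2).integrable_sq
      exact this
    rw [← ofReal_integral_eq_lintegral_ofReal hint (Eventually.of_forall fun X => sq_nonneg _),
      ENNReal.toReal_ofReal (integral_nonneg fun X => sq_nonneg _)]
  have hmeas : Measurable fun ω : PathSpace N =>
      ∫⁻ X in cellN N L, ENNReal.ofReal ((f (X + displacement t ω) - f X) ^ 2) :=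
    (measurable_setLIntegral_cellN_shift_sq L hf).comp (measurable_displacement t)
  have hbound : ∀ ω : PathSpace N, ∫⁻ X in cellN N L, ENNReal.ofReal ((f (X + displacement t ω) - f X) ^ 2) ≤
      4 * ∫⁻ X in cellN N L, ENNReal.ofReal (f X ^ 2) := fun ω => setLIntegral_cellN_shift_sq_le hL hf hper _
  have hlt : ∀ ω : PathSpace N, ∫⁻ X in cellN N L, ENNReal.ofReal ((f (X + displacement t ω) - f X) ^ 2) < ⊤ :=
    fun ω => (hbound ω).trans_lt (ENNReal.mul_lt_top (by norm_num) hsq.lt_top)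
  simp_rw [hinner]
  constructor
  · refine (integrable_toReal_of_lintegral_ne_top hmeas.aemeasurable ?_)
    refine ne_of_lt (lt_of_le_of_lt (lintegral_mono hbound) ?_)
    rw [lintegral_const, measure_univ, mul_one]
    exact ENNReal.mul_lt_top (by norm_num) hsq.lt_top
  · rw [integral_toReal hmeas.aemeasurable (Eventually.of_forall hlt)]
    rfl

/-- **The square identity on the cell**: for periodic `f ∈ L²([0,L)^{3N})` and every `t`,
`∫_cell f(X) E[f(X + √2 b_t)] dX = ‖f‖²_cell - sqIncrCell t f / 2` (Fubini, then the fixed-shift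
identity). [folklore] -/
theorem integral_cellN_mul_integral_shift_eq {L : ℝ} (hL : 0 < L) {f : Config N → ℝ}
    (hf : Measurable f) (hf2 : MemLp f 2 (volume.restrict (cellN N L)))
    (hper : ∀ (X : Config N) (i : Fin N) (k : Fin 3),
      f (X + Pi.single i (EuclideanSpace.single k L)) = f X) (t : ℝ≥0) :
    ∫ X in cellN N L, f X * ∫ ω, f (X + displacement t ω) ∂wienerPaths N =
      (∫ X in cellN N L, f X ^ 2) - (sqIncrCell L t f).toReal / 2 := by
  have hI := integrable_mul_comp_add_displacement_cellN hL hf hf2 hper t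
  calc ∫ X in cellN N L, f X * ∫ ω, f (X + displacement t ω) ∂wienerPaths N
      = ∫ X in cellN N L, (∫ ω, f X * f (X + displacement t ω) ∂wienerPaths N) := by
        refine integral_congr_ae (Eventually.of_forall fun X => ?_)
        exact (MeasureTheory.integral_const_mul _ _).symm
    _ = ∫ ω, (∫ X in cellN N L, f X * f (X + displacement t ω)) ∂wienerPaths N :=
        integral_integral_swap hI
    _ = ∫ ω, ((∫ X in cellN N L, f X ^ 2) -
          (1 / 2) * ∫ X in cellN N L, (f (X + displacement t ω) - f X) ^ 2) ∂wienerPaths N := by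
        refine integral_congr_ae (Eventually.of_forall fun ω => ?_)
        exact integral_cellN_mul_shift_eq hL hf2 hper _
    _ = (∫ X in cellN N L, f X ^ 2) - (sqIncrCell L t f).toReal / 2 := by
        obtain ⟨hint, heq⟩ := integral_shift_sq_displacement_cellN hL hf hf2 hper t
        rw [integral_sub (integrable_const _) (hint.const_mul _), MeasureTheory.integral_const,
          MeasureTheory.integral_const_mul, heq]
        simp only [probReal_univ, one_smul]
        ring

/-! ### The `C¹` upper bound `sqIncrCell t φ ≤ 2t ∫_cell |∇φ|²` -/

/-- **Integrated form on the cell**: `∫_cell (φ(X + h) - φ X)² dX ≤ ∫_cell (Dφ(Y) h)² dY` for a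
periodic `C¹` function (Tonelli and shift invariance of cell integrals of the periodic integrand
`Y ↦ (Dφ(Y) h)²`). [folklore] -/
theorem setLIntegral_cellN_sq_sub_le {L : ℝ} (hL : 0 < L) {φ : Config N → ℝ} (hφ : ContDiff ℝ 1 φ)
    (hper : ∀ (X : Config N) (i : Fin N) (k : Fin 3),
      φ (X + Pi.single i (EuclideanSpace.single k L)) = φ X) (h : Config N) :
    ∫⁻ X in cellN N L, ENNReal.ofReal ((φ (X + h) - φ X) ^ 2) ≤
      ∫⁻ Y in cellN N L, ENNReal.ofReal ((fderiv ℝ φ Y h) ^ 2) := by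
  have hcont2 : Continuous fun p : Config N × ℝ => (fderiv ℝ φ (p.1 + p.2 • h) h) ^ 2 :=
    (((hφ.continuous_fderiv one_ne_zero).comp (by fun_prop)).clm_apply continuous_const).pow 2
  have hperD : ∀ (Y : Config N) (i : Fin N) (k : Fin 3),
      ENNReal.ofReal ((fderiv ℝ φ (Y + Pi.single i (EuclideanSpace.single k L)) h) ^ 2) =
        ENNReal.ofReal ((fderiv ℝ φ Y h) ^ 2) := fun Y i k => by rw [fderiv_periodic hper]
  calc ∫⁻ X in cellN N L, ENNReal.ofReal ((φ (X + h) - φ X) ^ 2)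
      ≤ ∫⁻ X in cellN N L, ENNReal.ofReal (∫ s in (0 : ℝ)..1, (fderiv ℝ φ (X + s • h) h) ^ 2) :=
        lintegral_mono fun X => ENNReal.ofReal_le_ofReal (sq_sub_le_integral_sq_fderiv hφ X h)
    _ = ∫⁻ X in cellN N L, ∫⁻ s in Set.Ioc (0 : ℝ) 1, ENNReal.ofReal ((fderiv ℝ φ (X + s • h) h) ^ 2) := by
        refine lintegral_congr fun X => ?_
        have hint : IntegrableOn (fun s : ℝ => (fderiv ℝ φ (X + s • h) h) ^ 2) (Set.Ioc 0 1) volume :=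
          (((continuous_fderiv_lineMap hφ X h).pow 2).continuousOn.integrableOn_compact
            isCompact_Icc).mono_set Set.Ioc_subset_Icc_self
        rw [integral_of_le zero_le_one,
          ofReal_integral_eq_lintegral_ofReal hint (Eventually.of_forall fun s => sq_nonneg _)]
    _ = ∫⁻ s in Set.Ioc (0 : ℝ) 1, ∫⁻ X in cellN N L, ENNReal.ofReal ((fderiv ℝ φ (X + s • h) h) ^ 2) :=
        lintegral_lintegral_swap
          ((ENNReal.measurable_ofReal.comp hcont2.measurable).aemeasurable)
    _ = ∫⁻ _s in Set.Ioc (0 : ℝ) 1, ∫⁻ Y in cellN N L, ENNReal.ofReal ((fderiv ℝ φ Y h) ^ 2) := by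
        refine lintegral_congr fun s => ?_
        exact lintegral_cellN_comp_add hL (G := fun Y => ENNReal.ofReal ((fderiv ℝ φ Y h) ^ 2))
          hperD (s • h)
    _ = ∫⁻ Y in cellN N L, ENNReal.ofReal ((fderiv ℝ φ Y h) ^ 2) := by
        rw [setLIntegral_const, Real.volume_Ioc, sub_zero, ENNReal.ofReal_one, mul_one]

/-- **The `C¹` upper bound on the cell**: `sqIncrCell t φ ≤ 2t ∫_cell |∇φ|²` for every periodic
`C¹` real function `φ` (`(φ(X+h)-φ(X))² ≤ ∫₀¹ (Dφ(X+sh)h)²`, shift invariance, and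
`E[(Dφ(Y) √2 b_t)²] = 2t |∇φ(Y)|²`). [folklore] -/
theorem sqIncrCell_le_kinetic {L : ℝ} (hL : 0 < L) {φ : Config N → ℝ} (hφ : ContDiff ℝ 1 φ)
    (hper : ∀ (X : Config N) (i : Fin N) (k : Fin 3),
      φ (X + Pi.single i (EuclideanSpace.single k L)) = φ X) (t : ℝ≥0) :
    sqIncrCell L t φ ≤ ENNReal.ofReal (2 * t) * ∫⁻ Y in cellN N L, realKinetic φ Y := by
  have hjoint : Measurable fun p : PathSpace N × Config N =>
      ENNReal.ofReal ((fderiv ℝ φ p.2 (displacement t p.1)) ^ 2) := by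
    have hc : Continuous fun q : Config N × Config N => (fderiv ℝ φ q.1 q.2) ^ 2 :=
      (((hφ.continuous_fderiv one_ne_zero).comp continuous_fst).clm_apply continuous_snd).pow 2
    exact ENNReal.measurable_ofReal.comp (hc.measurable.comp
      (measurable_snd.prodMk ((measurable_displacement t).comp measurable_fst)))
  calc sqIncrCell L t φ
      ≤ ∫⁻ ω, ∫⁻ Y in cellN N L, ENNReal.ofReal ((fderiv ℝ φ Y (displacement t ω)) ^ 2) ∂volume
          ∂wienerPaths N := lintegral_mono fun ω => setLIntegral_cellN_sq_sub_le hL hφ hper _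
    _ = ∫⁻ Y in cellN N L, ∫⁻ ω, ENNReal.ofReal ((fderiv ℝ φ Y (displacement t ω)) ^ 2) ∂wienerPaths N
          ∂volume := lintegral_lintegral_swap hjoint.aemeasurable
    _ = ∫⁻ Y in cellN N L, ENNReal.ofReal (2 * (t : ℝ) *
          ∑ i, ∑ k, (fderiv ℝ φ Y (Pi.single i (EuclideanSpace.single k (1 : ℝ)))) ^ 2) := by
        refine lintegral_congr fun Y => ?_
        exact lintegral_clm_displacement_sq (fderiv ℝ φ Y) t
    _ = ENNReal.ofReal (2 * t) * ∫⁻ Y in cellN N L, realKinetic φ Y := by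
        rw [← lintegral_const_mul' _ _ ENNReal.ofReal_ne_top]
        refine lintegral_congr fun Y => ?_
        rw [realKinetic_eq_ofReal, ← ENNReal.ofReal_mul (by positivity)]

/-! ### The Fatou lower bound `∫_cell |∇φ|² ≤ liminf sqIncrCell t φ / (2t)` -/

/-- **Scaling representation of `sqIncrCell`**: for `t > 0`,
`sqIncrCell t f = ∫∫_cell (f(X + √(2t) z) - f X)² dX dγ(z)`. [folklore] -/
theorem sqIncrCell_eq_lintegral_stdGaussian (L : ℝ) {f : Config N → ℝ} (hf : Measurable f)
    {t : ℝ≥0} (ht : t ≠ 0) :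
    sqIncrCell L t f = ∫⁻ z, ∫⁻ X in cellN N L, ENNReal.ofReal ((f (X + Real.sqrt (2 * t) • z) - f X) ^ 2)
      ∂volume ∂stdGaussian N := by
  rw [sqIncrCell_eq_lintegral_shift]
  exact (lintegral_stdGaussian_smul ht (measurable_setLIntegral_cellN_shift_sq L hf)).symm

/-- **The Fatou lower bound on the cell**: for every periodic `C¹` real function `φ` on `(ℝ³)^N`,
`∫_cell |∇φ|² ≤ liminf_{t → 0⁺} sqIncrCell t φ / (2t)`. [folklore] -/
theorem kinetic_le_liminf_sqIncrCell (L : ℝ) {φ : Config N → ℝ} (hφ : ContDiff ℝ 1 φ) :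
    ∫⁻ Y in cellN N L, realKinetic φ Y ≤
      liminf (fun t : ℝ≥0 => (ENNReal.ofReal (2 * t))⁻¹ * sqIncrCell L t φ) (𝓝[>] 0) := by
  have hφm : Measurable φ := hφ.continuous.measurable
  set G : ℝ≥0 → Config N × Config N → ℝ≥0∞ := fun t p => (ENNReal.ofReal (2 * t))⁻¹ *
      ENNReal.ofReal ((φ (p.2 + Real.sqrt (2 * t) • p.1) - φ p.2) ^ 2) with hG
  have hGm : ∀ t, Measurable (G t) := fun t => measurable_sqIncr_integrand_smul hφm t
  -- the rescaled `sqIncrCell` as a product integral, for `t > 0`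
  have hrepr : ∀ᶠ t : ℝ≥0 in 𝓝[>] 0, (ENNReal.ofReal (2 * t))⁻¹ * sqIncrCell L t φ =
      ∫⁻ p, G t p ∂((stdGaussian N).prod (volume.restrict (cellN N L))) := by
    filter_upwards [self_mem_nhdsWithin] with t ht
    have ht0 : t ≠ 0 := ne_of_gt ht
    rw [sqIncrCell_eq_lintegral_stdGaussian L hφm ht0, lintegral_prod _ (hGm t).aemeasurable]
    simp only [hG]
    rw [← lintegral_const_mul' _ _ (ENNReal.inv_ne_top.2 ?_)]
    · refine lintegral_congr fun z => ?_
      rw [lintegral_const_mul' _ _ (ENNReal.inv_ne_top.2 ?_)]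
      exact (ENNReal.ofReal_pos.2 (mul_pos two_pos (by exact_mod_cast ht))).ne'
    · exact (ENNReal.ofReal_pos.2 (mul_pos two_pos (by exact_mod_cast ht))).ne'
  rw [liminf_congr hrepr]
  -- pointwise liminf
  have hpt : ∀ p : Config N × Config N, liminf (fun t => G t p) (𝓝[>] (0 : ℝ≥0)) =
      ENNReal.ofReal ((fderiv ℝ φ p.2 p.1) ^ 2) := fun p =>
    (tendsto_sqIncr_integrand hφ p.1 p.2).liminf_eq
  -- the left-hand side as a product integral
  have hlhs : ∫⁻ Y in cellN N L, realKinetic φ Y =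
      ∫⁻ p, ENNReal.ofReal ((fderiv ℝ φ p.2 p.1) ^ 2) ∂((stdGaussian N).prod (volume.restrict (cellN N L))) := by
    have hm : Measurable fun p : Config N × Config N => ENNReal.ofReal ((fderiv ℝ φ p.2 p.1) ^ 2) := by
      have hc : Continuous fun q : Config N × Config N => (fderiv ℝ φ q.2 q.1) ^ 2 :=
        (((hφ.continuous_fderiv one_ne_zero).comp continuous_snd).clm_apply continuous_fst).pow 2
      exact ENNReal.measurable_ofReal.comp hc.measurable
    rw [lintegral_prod_symm _ hm.aemeasurable]
    refine lintegral_congr fun Y => ?_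
    rw [lintegral_clm_sq_stdGaussian (fderiv ℝ φ Y), realKinetic_eq_ofReal]
  rw [hlhs]
  calc ∫⁻ p, ENNReal.ofReal ((fderiv ℝ φ p.2 p.1) ^ 2) ∂((stdGaussian N).prod (volume.restrict (cellN N L)))
      = ∫⁻ p, liminf (fun t => G t p) (𝓝[>] (0 : ℝ≥0))
          ∂((stdGaussian N).prod (volume.restrict (cellN N L))) := lintegral_congr fun p => (hpt p).symm
    _ ≤ liminf (fun t => ∫⁻ p, G t p ∂((stdGaussian N).prod (volume.restrict (cellN N L))))
          (𝓝[>] (0 : ℝ≥0)) := lintegral_liminf_le hGm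

/-! ### Mollification does not increase `sqIncrCell` -/

/-- **Mollification does not increase the cell shift functional**: for periodic bounded `g` and a
probability measure `ν`, `∫_cell (ḡ(X + h) - ḡ(X))² dX ≤ ∫_cell (g(X + h) - g(X))² dX` with
`ḡ = ∫ g(· - y) dν`. [folklore] -/
theorem setLIntegral_cellN_sq_sub_conv_le {L : ℝ} (hL : 0 < L) {g : Config N → ℝ} (hg : Measurable g)
    {C : ℝ} (hC : ∀ x, |g x| ≤ C)
    (hper : ∀ (X : Config N) (i : Fin N) (k : Fin 3),
      g (X + Pi.single i (EuclideanSpace.single k L)) = g X)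
    (ν : Measure (Config N)) [IsProbabilityMeasure ν] (h : Config N) :
    ∫⁻ X in cellN N L, ENNReal.ofReal (((∫ y, g (X + h - y) ∂ν) - ∫ y, g (X - y) ∂ν) ^ 2) ≤
      ∫⁻ X in cellN N L, ENNReal.ofReal ((g (X + h) - g X) ^ 2) := by
  have hmeas2 : Measurable fun p : Config N × Config N =>
      ENNReal.ofReal ((g (p.1 + h - p.2) - g (p.1 - p.2)) ^ 2) :=
    ENNReal.measurable_ofReal.comp (((hg.comp ((measurable_fst.add_const h).sub measurable_snd)).sub
      (hg.comp (measurable_fst.sub measurable_snd))).pow_const 2)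
  have hperS : ∀ (X : Config N) (i : Fin N) (k : Fin 3),
      ENNReal.ofReal ((g (X + Pi.single i (EuclideanSpace.single k L) + h) -
        g (X + Pi.single i (EuclideanSpace.single k L))) ^ 2) = ENNReal.ofReal ((g (X + h) - g X) ^ 2) := by
    intro X i k
    rw [add_right_comm, hper, hper]
  calc ∫⁻ X in cellN N L, ENNReal.ofReal (((∫ y, g (X + h - y) ∂ν) - ∫ y, g (X - y) ∂ν) ^ 2)
      ≤ ∫⁻ X in cellN N L, ENNReal.ofReal (∫ y, (g (X + h - y) - g (X - y)) ^ 2 ∂ν) :=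
        lintegral_mono fun X => ENNReal.ofReal_le_ofReal (sq_sub_conv_le hg hC ν X h)
    _ = ∫⁻ X in cellN N L, ∫⁻ y, ENNReal.ofReal ((g (X + h - y) - g (X - y)) ^ 2) ∂ν := by
        refine lintegral_congr fun X => ?_
        refine ofReal_integral_eq_lintegral_ofReal ?_ (Eventually.of_forall fun y => sq_nonneg _)
        refine Integrable.of_bound ?_ ((C + C) ^ 2) (Eventually.of_forall fun y => ?_)
        · exact ((((hg.comp (measurable_const.sub measurable_id)).sub
            (hg.comp (measurable_const.sub measurable_id))).pow_const 2).aestronglyMeasurable)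
        · rw [Real.norm_eq_abs, abs_pow, sq_le_sq₀ (abs_nonneg _) (by
            linarith [abs_nonneg (g X), hC X])]
          exact (abs_sub _ _).trans (add_le_add (hC _) (hC _))
    _ = ∫⁻ y, ∫⁻ X in cellN N L, ENNReal.ofReal ((g (X + h - y) - g (X - y)) ^ 2) ∂volume ∂ν :=
        lintegral_lintegral_swap hmeas2.aemeasurable
    _ = ∫⁻ _y, ∫⁻ X in cellN N L, ENNReal.ofReal ((g (X + h) - g X) ^ 2) ∂volume ∂ν := by
        refine lintegral_congr fun y => ?_
        have htr := lintegral_cellN_comp_add hL (G := fun X => ENNReal.ofReal ((g (X + h) - g X) ^ 2))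
          hperS (-y)
        rw [← htr]
        refine lintegral_congr fun X => ?_
        simp only [← sub_eq_add_neg, sub_add_eq_add_sub]
    _ = ∫⁻ X in cellN N L, ENNReal.ofReal ((g (X + h) - g X) ^ 2) := by
        rw [lintegral_const, measure_univ, mul_one]

/-- **Mollification does not increase `sqIncrCell`**: for a probability measure `ν` on `(ℝ³)^N` and
a bounded measurable periodic `g`, the average `ḡ(x) = ∫ g(x - y) dν(y)` satisfies
`sqIncrCell t ḡ ≤ sqIncrCell t g`. [folklore] -/
theorem sqIncrCell_conv_le {L : ℝ} (hL : 0 < L) {g : Config N → ℝ} (hg : Measurable g) {C : ℝ}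
    (hC : ∀ x, |g x| ≤ C)
    (hper : ∀ (X : Config N) (i : Fin N) (k : Fin 3),
      g (X + Pi.single i (EuclideanSpace.single k L)) = g X)
    (ν : Measure (Config N)) [IsProbabilityMeasure ν] (t : ℝ≥0) :
    sqIncrCell L t (fun x => ∫ y, g (x - y) ∂ν) ≤ sqIncrCell L t g :=
  lintegral_mono fun ω => setLIntegral_cellN_sq_sub_conv_le hL hg hC hper ν (displacement t ω)

end Literature.MathematicalPhysics.QuantumManyBody.BoseGas

end
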